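import Mathlib
import HarnessLib
import Summits.Ventures.LatticeQCDFlow.Exactness.IMHDelayedRejectionExact

/-!
# LatticeQCDFlow / Exactness — THE SECOND CHANCE IS A BEST-OF-TWO TEST: the delayed-rejection flow sampler leaves `x` exactly as
# often as a Metropolis test against the HEAVIER of two flow draws; its second stage is an upgrade-only move worth at most half the
# flow's Gini mean difference of the weight, over `w(x)`

HONEST FRAMING: exact (Metropolis-corrected) sampling algorithms for lattice gauge theory;
figures of merit are autocorrelation/cost numbers at stated couplings and volumes; no
continuum-physics claim.

Venture `LatticeQCDFlow` (cell pub-lqcd), topic `Exactness`, FANOUT row 30 (lean-1 GEN-43, theme SECOND CHANCES; sequel of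
`IMHDelayedRejectionExact`).  NEW WORK of the cell (elementary real identities, then Tonelli over `q ⊗ q`); no definition is
introduced, nothing is cited as a fact.  Printed counterpart NAMED ONLY: none known to us for the best-of-two identity; the Gini mean
difference `E|w(Y) − w(Y′)|` is classical.

## Setting (general measurable `Ω`; flow law `q`; weight `w > 0`; `a(x, y) = min(1, w(y)/w(x))`, `A(x) = ∫ a(x, ·) dq`;
## second-stage product density `d(x, y₁, y₂) = min(1 − a(x, y₁), w(y₂)(1 − a(y₂, y₁))/w(x))` of `IMHDelayedRejectionExact`)

## Results [all ours]

* **`drSecond_eq_posPart` (CLOSED FORM)**: `d(x, y₁, y₂) = (min(w(x), w(y₂)) − w(y₁))⁺ / w(x)`.  Hence `drSecond_eq_zero_of_le`: the second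
  stage NEVER accepts a draw lighter than the rejected one (`w(y₂) ≤ w(y₁) ⇒ d = 0`) — IT IS AN UPGRADE-ONLY MOVE; and
  `mul_drSecond_eq_posPart`: `w(x)·d = (min(w(x), w(y₂)) − w(y₁))⁺`, symmetric in `x ↔ y₂` at sight (the flux symmetry of the parent file).
* **`imhAccept_add_drSecond` (BEST OF TWO)**: `a(x, y₁) + d(x, y₁, y₂) = min(1, max(w(y₁), w(y₂))/w(x))` pointwise; integrated,
  **`drMass_eq_bestOfTwo`**: the move mass of one delayed-rejection update is
  `m(x) = A(x) + ∫∫ d = ∫∫ min(1, max(w(y₁), w(y₂))/w(x)) q(dy₁) q(dy₂)` — EXACTLY the acceptance probability of ONE Metropolis test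
  against the heavier of two independent flow draws.  (The kernels differ — delayed rejection keeps an accepted first draw even if the
  second would be heavier — but the escape probabilities coincide.)
* `drMass_le_two_mul_acceptMass`: `A(x) ≤ m(x) ≤ 2A(x)` — the second chance at most doubles the acceptance (sharper than `2Z/w(x)`).
* **`drGain_le_half_gini`**: the gain `m(x) − A(x) = ∫∫ (min(w(x), w(y₂)) − w(y₁))⁺/w(x)` is at most `G/(2w(x))`,
  `G = ∫∫ |w(y₁) − w(y₂)| q(dy₁) q(dy₂)` the flow's Gini mean difference of the weight (`two_mul_lintegral_posPart_sub`:
  `2∫∫ (w(y₂) − w(y₁))⁺ = G` by Tonelli), with EQUALITY from every configuration at least as heavy as all flow draws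
  (`drGain_eq_half_gini_of_heaviest`): a well-trained flow (small `G`) leaves little for a second chance to buy, and the heaviest
  configurations — where the plain sampler sticks — gain the least in absolute terms.
* **`sq_one_sub_acceptMass_le_one_sub_drMass`**: `(1 − A(x))² ≤ 1 − m(x)` — one delayed-rejection update holds at least as often as TWO
  plain updates: a second chance inside an update is weaker than a second update (if cheaper: `2 − A(x)` weight evaluations, not `2`).
-/

namespace Summit.Ventures.LatticeQCDFlow.Exactness

open MeasureTheory ProbabilityTheory
open scoped ENNReal

variable {Ω : Type*} [MeasurableSpace Ω] {q : Measure Ω} [IsProbabilityMeasure q] {w : Ω → ℝ}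

/-! ## §0 Real identities -/

/-- `min(a⁺, b⁺) = (min a b)⁺`. [folklore] -/
theorem min_max_zero_eq (a b : ℝ) : min (max a 0) (max b 0) = max (min a b) 0 := by
  rcases le_total a b with h | h
  · rw [min_eq_left (max_le_max h le_rfl), min_eq_left h]
  · rw [min_eq_right (max_le_max h le_rfl), min_eq_right h]

/-- **The best-of-two identity**: `min c b + (min c b' − b)⁺ = min c (max b b')`. [folklore] -/
theorem min_add_posPart_eq (c b b' : ℝ) : min c b + max (min c b' - b) 0 = min c (max b b') := by
  rcases le_total b b' with h | h
  · rw [max_eq_right h]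
    rcases le_total c b with h1 | h1
    · rw [min_eq_left h1, min_eq_left (h1.trans h), max_eq_right (by linarith), add_zero]
    · rw [min_eq_right h1, max_eq_left (by rw [sub_nonneg]; exact le_min h1 h)]; ring
  · rw [max_eq_left h, max_eq_right (by linarith [min_le_right c b']), add_zero]

/-- `min 1 (max a b / c) ≤ min 1 (a/c) + min 1 (b/c)` for `a, b ≥ 0 < c`. [folklore] -/
theorem min_one_max_div_le {a b c : ℝ} (ha : 0 ≤ a) (hb : 0 ≤ b) (hc : 0 < c) :
    min 1 (max a b / c) ≤ min 1 (a / c) + min 1 (b / c) := by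
  have h1 : 0 ≤ min 1 (a / c) := le_min zero_le_one (div_nonneg ha hc.le)
  have h2 : 0 ≤ min 1 (b / c) := le_min zero_le_one (div_nonneg hb hc.le)
  rcases le_total a b with h | h
  · rw [max_eq_right h]; linarith
  · rw [max_eq_left h]; linarith

/-- `(b' − b)⁺ + (b − b')⁺ = |b − b'|`. [folklore] -/
theorem posPart_add_posPart_eq_abs (b b' : ℝ) : max (b' - b) 0 + max (b - b') 0 = |b - b'| := by
  rcases le_total b b' with h | h
  · rw [max_eq_left (sub_nonneg.2 h), max_eq_right (by linarith), abs_of_nonpos (by linarith)]; ring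
  · rw [max_eq_right (by linarith), max_eq_left (sub_nonneg.2 h), abs_of_nonneg (by linarith)]; ring

omit [MeasurableSpace Ω] in
/-- **The first-stage rejection probability in closed form**: `1 − a(x, y) = (w(x) − w(y))⁺/w(x)`. [ours] -/
theorem one_sub_imhAccept_eq (hw0 : ∀ x, 0 < w x) (x y : Ω) : 1 - imhAccept w x y = max (w x - w y) 0 / w x := by
  unfold imhAccept
  have hx := hw0 x
  rcases le_total (w y) (w x) with h | h
  · rw [min_eq_right ((div_le_one hx).2 h), max_eq_left (sub_nonneg.2 h), sub_div, div_self hx.ne']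
  · rw [min_eq_left ((one_le_div hx).2 h), max_eq_right (by linarith), zero_div, sub_self]

omit [MeasurableSpace Ω] in
/-- `w(y)·(1 − a(y, y₁)) = (w(y) − w(y₁))⁺`. [ours] -/
theorem mul_one_sub_imhAccept_eq (hw0 : ∀ x, 0 < w x) (y y₁ : Ω) : w y * (1 - imhAccept w y y₁) = max (w y - w y₁) 0 := by
  rw [one_sub_imhAccept_eq hw0, mul_div_assoc', mul_div_cancel_left₀ _ (hw0 y).ne']

/-! ## §1 The second stage in closed form: an upgrade-only move -/

omit [MeasurableSpace Ω] in
/-- **CLOSED FORM OF THE SECOND-STAGE PRODUCT DENSITY**: `d(x, y₁, y₂) = (min(w(x), w(y₂)) − w(y₁))⁺ / w(x)`. [ours] -/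
theorem drSecond_eq_posPart (hw0 : ∀ x, 0 < w x) (x y₁ y₂ : Ω) :
    min (1 - imhAccept w x y₁) (w y₂ * (1 - imhAccept w y₂ y₁) / w x) = max (min (w x) (w y₂) - w y₁) 0 / w x := by
  rw [one_sub_imhAccept_eq hw0, mul_one_sub_imhAccept_eq hw0, min_div_div_right (hw0 x).le, min_max_zero_eq,
    min_sub_sub_right]

omit [MeasurableSpace Ω] in
/-- **… so the second-stage flux is `w(x)·d = (min(w(x), w(y₂)) − w(y₁))⁺`** — symmetric under `x ↔ y₂` at sight. [ours] -/
theorem mul_drSecond_eq_posPart (hw0 : ∀ x, 0 < w x) (x y₁ y₂ : Ω) :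
    w x * min (1 - imhAccept w x y₁) (w y₂ * (1 - imhAccept w y₂ y₁) / w x) = max (min (w x) (w y₂) - w y₁) 0 := by
  rw [drSecond_eq_posPart hw0, mul_div_assoc', mul_div_cancel_left₀ _ (hw0 x).ne']

omit [MeasurableSpace Ω] in
/-- **THE SECOND STAGE IS UPGRADE-ONLY**: a second draw no heavier than the rejected first draw is never accepted. [ours] -/
theorem drSecond_eq_zero_of_le (hw0 : ∀ x, 0 < w x) {x y₁ y₂ : Ω} (h : w y₂ ≤ w y₁) :
    min (1 - imhAccept w x y₁) (w y₂ * (1 - imhAccept w y₂ y₁) / w x) = 0 := by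
  rw [drSecond_eq_posPart hw0, max_eq_right (by linarith [min_le_right (w x) (w y₂)]), zero_div]

omit [MeasurableSpace Ω] in
/-- … and neither is any second draw after a first draw at least as heavy as the current configuration (the first stage accepted surely). [ours] -/
theorem drSecond_eq_zero_of_le' (hw0 : ∀ x, 0 < w x) {x y₁ : Ω} (y₂ : Ω) (h : w x ≤ w y₁) :
    min (1 - imhAccept w x y₁) (w y₂ * (1 - imhAccept w y₂ y₁) / w x) = 0 := by
  rw [drSecond_eq_posPart hw0, max_eq_right (by linarith [min_le_left (w x) (w y₂)]), zero_div]

omit [MeasurableSpace Ω] in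
/-- **The second stage fires with positive probability iff the rejected draw is lighter than BOTH the current configuration and the second
draw.** [ours] -/
theorem drSecond_pos_iff (hw0 : ∀ x, 0 < w x) (x y₁ y₂ : Ω) :
    0 < min (1 - imhAccept w x y₁) (w y₂ * (1 - imhAccept w y₂ y₁) / w x) ↔ w y₁ < w x ∧ w y₁ < w y₂ := by
  rw [drSecond_eq_posPart hw0, div_pos_iff_of_pos_right (hw0 x), lt_max_iff, lt_self_iff_false, or_false, sub_pos, lt_min_iff]

/-! ## §2 Best of two -/

omit [MeasurableSpace Ω] in
/-- **BEST OF TWO, POINTWISE**: `a(x, y₁) + d(x, y₁, y₂) = min(1, max(w(y₁), w(y₂))/w(x))`. [ours] -/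
theorem imhAccept_add_drSecond (hw0 : ∀ x, 0 < w x) (x y₁ y₂ : Ω) :
    imhAccept w x y₁ + min (1 - imhAccept w x y₁) (w y₂ * (1 - imhAccept w y₂ y₁) / w x) =
      min 1 (max (w y₁) (w y₂) / w x) := by
  have hx := hw0 x
  have ha : imhAccept w x y₁ = min (w x) (w y₁) / w x := by
    unfold imhAccept; rw [← min_div_div_right hx.le, div_self hx.ne']
  rw [drSecond_eq_posPart hw0, ha, ← add_div, min_add_posPart_eq, ← min_div_div_right hx.le, div_self hx.ne']

omit [MeasurableSpace Ω] in
/-- The same in `ℝ≥0∞`: `imhAcceptE w x y₁ + ofReal d = ofReal (min 1 (max(w y₁, w y₂)/w x))`. [ours, bookkeeping] -/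
theorem imhAcceptE_add_drSecond (hw0 : ∀ x, 0 < w x) (x y₁ y₂ : Ω) :
    imhAcceptE w x y₁ + ENNReal.ofReal (min (1 - imhAccept w x y₁) (w y₂ * (1 - imhAccept w y₂ y₁) / w x)) =
      ENNReal.ofReal (min 1 (max (w y₁) (w y₂) / w x)) := by
  rw [imhAcceptE, ← ENNReal.ofReal_add (imhAccept_nonneg hw0 x y₁) (drSecond_nonneg hw0 x y₁ y₂), imhAccept_add_drSecond hw0]

/-- Joint measurability of the best-of-two acceptance. [ours, bookkeeping] -/
theorem measurable_bestOfTwo (hw : Measurable w) (x : Ω) :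
    Measurable (Function.uncurry fun y₁ y₂ : Ω => ENNReal.ofReal (min 1 (max (w y₁) (w y₂) / w x))) :=
  (measurable_const.min (((hw.comp measurable_fst).max (hw.comp measurable_snd)).div measurable_const)).ennreal_ofReal

/-- **THE DELAYED-REJECTION MOVE MASS IS THE BEST-OF-TWO ACCEPTANCE**:
`A(x) + ∫∫ d(x, y₁, y₂) q(dy₂) q(dy₁) = ∫∫ min(1, max(w(y₁), w(y₂))/w(x)) q(dy₂) q(dy₁)`. [ours] -/
theorem drMass_eq_bestOfTwo (hw : Measurable w) (hw0 : ∀ x, 0 < w x) (x : Ω) :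
    imhAcceptMass q w x +
        ∫⁻ y₁, ∫⁻ y₂, ENNReal.ofReal (min (1 - imhAccept w x y₁) (w y₂ * (1 - imhAccept w y₂ y₁) / w x)) ∂q ∂q =
      ∫⁻ y₁, ∫⁻ y₂, ENNReal.ofReal (min 1 (max (w y₁) (w y₂) / w x)) ∂q ∂q := by
  have ha : Measurable fun y => imhAcceptE w x y := (measurable_imhAcceptE hw).of_uncurry_left
  rw [imhAcceptMass, ← lintegral_add_left ha]
  refine lintegral_congr fun y₁ => ?_
  rw [← mul_one (imhAcceptE w x y₁), ← measure_univ (μ := q), ← lintegral_const, ← lintegral_add_left measurable_const]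
  exact lintegral_congr fun y₂ => imhAcceptE_add_drSecond hw0 x y₁ y₂

/-- **`A(x) ≤ m(x) ≤ 2A(x)`**: the second chance at most doubles the acceptance. [ours] -/
theorem drMass_le_two_mul_acceptMass (hw : Measurable w) (hw0 : ∀ x, 0 < w x) (x : Ω) :
    imhAcceptMass q w x +
        ∫⁻ y₁, ∫⁻ y₂, ENNReal.ofReal (min (1 - imhAccept w x y₁) (w y₂ * (1 - imhAccept w y₂ y₁) / w x)) ∂q ∂q ≤
      2 * imhAcceptMass q w x := by
  have ha : Measurable fun y => imhAcceptE w x y := (measurable_imhAcceptE hw).of_uncurry_left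
  rw [drMass_eq_bestOfTwo hw hw0 x, two_mul]
  calc ∫⁻ y₁, ∫⁻ y₂, ENNReal.ofReal (min 1 (max (w y₁) (w y₂) / w x)) ∂q ∂q
      ≤ ∫⁻ y₁, ∫⁻ y₂, (imhAcceptE w x y₁ + imhAcceptE w x y₂) ∂q ∂q := by
        refine lintegral_mono fun y₁ => lintegral_mono fun y₂ => ?_
        rw [imhAcceptE, imhAcceptE, ← ENNReal.ofReal_add (imhAccept_nonneg hw0 x y₁) (imhAccept_nonneg hw0 x y₂)]
        exact ENNReal.ofReal_le_ofReal (min_one_max_div_le (hw0 y₁).le (hw0 y₂).le (hw0 x))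
    _ = ∫⁻ y₁, (imhAcceptE w x y₁ + imhAcceptMass q w x) ∂q := by
        refine lintegral_congr fun y₁ => ?_
        rw [lintegral_add_left measurable_const, lintegral_const, measure_univ, mul_one, imhAcceptMass]
    _ = imhAcceptMass q w x + imhAcceptMass q w x := by
        rw [lintegral_add_right _ measurable_const, lintegral_const, measure_univ, mul_one, imhAcceptMass]

/-! ## §3 The gain and the Gini mean difference -/

omit [MeasurableSpace Ω] in
/-- `(min(w x, w y₂) − w y₁)⁺ ≤ (w y₂ − w y₁)⁺`, with equality when `w(x) ≥ w(y₂)`. [ours] -/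
theorem posPart_min_sub_le (x y₁ y₂ : Ω) : max (min (w x) (w y₂) - w y₁) 0 ≤ max (w y₂ - w y₁) 0 :=
  max_le_max (sub_le_sub_right (min_le_right _ _) _) le_rfl

/-- Measurability of `(y₁, y₂) ↦ ofReal (w y₂ − w y₁)⁺`. [ours, bookkeeping] -/
theorem measurable_posPart_sub (hw : Measurable w) :
    Measurable (Function.uncurry fun y₁ y₂ : Ω => ENNReal.ofReal (max (w y₂ - w y₁) 0)) :=
  (((hw.comp measurable_snd).sub (hw.comp measurable_fst)).max measurable_const).ennreal_ofReal

omit [IsProbabilityMeasure q] in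
/-- **THE GAIN IS AT MOST `∫∫ (w(y₂) − w(y₁))⁺ / w(x)`**. [ours] -/
theorem drGain_le (hw0 : ∀ x, 0 < w x) (x : Ω) :
    ∫⁻ y₁, ∫⁻ y₂, ENNReal.ofReal (min (1 - imhAccept w x y₁) (w y₂ * (1 - imhAccept w y₂ y₁) / w x)) ∂q ∂q ≤
      ENNReal.ofReal (w x)⁻¹ * ∫⁻ y₁, ∫⁻ y₂, ENNReal.ofReal (max (w y₂ - w y₁) 0) ∂q ∂q := by
  rw [← lintegral_const_mul' _ _ ENNReal.ofReal_ne_top]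
  refine lintegral_mono fun y₁ => ?_
  rw [← lintegral_const_mul' _ _ ENNReal.ofReal_ne_top]
  refine lintegral_mono fun y₂ => ?_
  rw [drSecond_eq_posPart hw0, ← ENNReal.ofReal_mul (inv_nonneg.2 (hw0 x).le), inv_mul_eq_div]
  exact ENNReal.ofReal_le_ofReal (div_le_div_of_nonneg_right (posPart_min_sub_le x y₁ y₂) (hw0 x).le)

omit [IsProbabilityMeasure q] in
/-- **… WITH EQUALITY FROM EVERY CONFIGURATION AT LEAST AS HEAVY AS ALL FLOW DRAWS.** [ours] -/
theorem drGain_eq_of_heaviest (hw0 : ∀ x, 0 < w x) {x : Ω} (hx : ∀ y, w y ≤ w x) :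
    ∫⁻ y₁, ∫⁻ y₂, ENNReal.ofReal (min (1 - imhAccept w x y₁) (w y₂ * (1 - imhAccept w y₂ y₁) / w x)) ∂q ∂q =
      ENNReal.ofReal (w x)⁻¹ * ∫⁻ y₁, ∫⁻ y₂, ENNReal.ofReal (max (w y₂ - w y₁) 0) ∂q ∂q := by
  rw [← lintegral_const_mul' _ _ ENNReal.ofReal_ne_top]
  refine lintegral_congr fun y₁ => ?_
  rw [← lintegral_const_mul' _ _ ENNReal.ofReal_ne_top]
  refine lintegral_congr fun y₂ => ?_
  rw [drSecond_eq_posPart hw0, ← ENNReal.ofReal_mul (inv_nonneg.2 (hw0 x).le), inv_mul_eq_div, min_eq_right (hx y₂)]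

omit [IsProbabilityMeasure q] in
/-- **TONELLI: `2∫∫ (w(y₂) − w(y₁))⁺ = ∫∫ |w(y₁) − w(y₂)|`** — twice the one-sided gain integral is the flow's Gini mean difference of the
weight. [ours] -/
theorem two_mul_lintegral_posPart_sub [SFinite q] (hw : Measurable w) :
    2 * ∫⁻ y₁, ∫⁻ y₂, ENNReal.ofReal (max (w y₂ - w y₁) 0) ∂q ∂q = ∫⁻ y₁, ∫⁻ y₂, ENNReal.ofReal |w y₁ - w y₂| ∂q ∂q := by
  have hm := measurable_posPart_sub hw
  have hm' : Measurable (Function.uncurry fun y₁ y₂ : Ω => ENNReal.ofReal (max (w y₁ - w y₂) 0)) :=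
    (((hw.comp measurable_fst).sub (hw.comp measurable_snd)).max measurable_const).ennreal_ofReal
  have hswap : ∫⁻ y₁, ∫⁻ y₂, ENNReal.ofReal (max (w y₂ - w y₁) 0) ∂q ∂q = ∫⁻ y₁, ∫⁻ y₂, ENNReal.ofReal (max (w y₁ - w y₂) 0) ∂q ∂q :=
    lintegral_lintegral_swap (hm.aemeasurable (μ := q.prod q))
  have h1 : Measurable fun y₁ => ∫⁻ y₂, ENNReal.ofReal (max (w y₁ - w y₂) 0) ∂q := hm'.lintegral_prod_right'
  rw [two_mul]
  nth_rewrite 1 [hswap]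
  rw [← lintegral_add_left h1]
  refine lintegral_congr fun y₁ => ?_
  have h2 : Measurable fun y₂ => ENNReal.ofReal (max (w y₁ - w y₂) 0) := hm'.of_uncurry_left
  rw [← lintegral_add_left h2]
  refine lintegral_congr fun y₂ => ?_
  rw [← ENNReal.ofReal_add (le_max_right _ _) (le_max_right _ _), posPart_add_posPart_eq_abs, abs_sub_comm]

/-- **THE GAIN IS AT MOST HALF THE GINI MEAN DIFFERENCE OVER `w(x)`**:
`2·w(x)·(m(x) − A(x)) ≤ G = ∫∫ |w(y₁) − w(y₂)| q(dy₁) q(dy₂)` (in the form `2·∫∫ d ≤ w(x)⁻¹·G`). [ours] -/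
theorem drGain_le_half_gini (hw : Measurable w) (hw0 : ∀ x, 0 < w x) (x : Ω) :
    2 * ∫⁻ y₁, ∫⁻ y₂, ENNReal.ofReal (min (1 - imhAccept w x y₁) (w y₂ * (1 - imhAccept w y₂ y₁) / w x)) ∂q ∂q ≤
      ENNReal.ofReal (w x)⁻¹ * ∫⁻ y₁, ∫⁻ y₂, ENNReal.ofReal |w y₁ - w y₂| ∂q ∂q := by
  rw [← two_mul_lintegral_posPart_sub hw, mul_left_comm]
  gcongr
  exact drGain_le hw0 x

/-- … with equality from the heaviest configurations: `2·∫∫ d = w(x)⁻¹·G` when `w(x) ≥ w(y)` for all `y`. [ours] -/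
theorem drGain_eq_half_gini_of_heaviest (hw : Measurable w) (hw0 : ∀ x, 0 < w x) {x : Ω} (hx : ∀ y, w y ≤ w x) :
    2 * ∫⁻ y₁, ∫⁻ y₂, ENNReal.ofReal (min (1 - imhAccept w x y₁) (w y₂ * (1 - imhAccept w y₂ y₁) / w x)) ∂q ∂q =
      ENNReal.ofReal (w x)⁻¹ * ∫⁻ y₁, ∫⁻ y₂, ENNReal.ofReal |w y₁ - w y₂| ∂q ∂q := by
  rw [← two_mul_lintegral_posPart_sub hw, mul_left_comm, drGain_eq_of_heaviest hw0 hx]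

/-! ## §4 A second chance is weaker than a second update -/

/-- `(1 − min(1, a/c))·(1 − min(1, b/c)) ≤ 1 − min(1, max(a, b)/c)` for `c > 0`: pointwise, holding through a best-of-two test is at least as
likely as holding through two independent tests. [folklore] -/
theorem one_sub_mul_one_sub_le_one_sub_bestOfTwo {a b c : ℝ} (ha : 0 ≤ a) (hb : 0 ≤ b) (hc : 0 < c) :
    (1 - min 1 (a / c)) * (1 - min 1 (b / c)) ≤ 1 - min 1 (max a b / c) := by
  rw [← max_div_div_right hc.le, min_max_distrib_left]
  have hu : min 1 (a / c) ≤ 1 := min_le_left _ _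
  have hv : min 1 (b / c) ≤ 1 := min_le_left _ _
  have hu0 : 0 ≤ min 1 (a / c) := le_min zero_le_one (div_nonneg ha hc.le)
  have hv0 : 0 ≤ min 1 (b / c) := le_min zero_le_one (div_nonneg hb hc.le)
  rcases le_total (min 1 (a / c)) (min 1 (b / c)) with h | h
  · rw [max_eq_right h]; nlinarith [mul_nonneg hu0 (sub_nonneg.2 hv)]
  · rw [max_eq_left h]; nlinarith [mul_nonneg hv0 (sub_nonneg.2 hu)]

omit [MeasurableSpace Ω] in
/-- The same in `ℝ≥0∞` with the sampler's acceptance densities. [ours, bookkeeping] -/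
theorem one_sub_imhAcceptE_mul_le (hw0 : ∀ x, 0 < w x) (x y₁ y₂ : Ω) :
    (1 - imhAcceptE w x y₁) * (1 - imhAcceptE w x y₂) ≤ 1 - ENNReal.ofReal (min 1 (max (w y₁) (w y₂) / w x)) := by
  have h1 : ∀ y, 1 - imhAcceptE w x y = ENNReal.ofReal (1 - imhAccept w x y) := fun y => by
    rw [imhAcceptE, ENNReal.ofReal_sub _ (imhAccept_nonneg hw0 x y), ENNReal.ofReal_one]
  have h2 : 1 - ENNReal.ofReal (min 1 (max (w y₁) (w y₂) / w x)) = ENNReal.ofReal (1 - min 1 (max (w y₁) (w y₂) / w x)) := by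
    rw [ENNReal.ofReal_sub _ (le_min zero_le_one (div_nonneg (le_max_of_le_left (hw0 y₁).le) (hw0 x).le)), ENNReal.ofReal_one]
  rw [h1, h1, h2, ← ENNReal.ofReal_mul (one_sub_imhAccept_nonneg w x y₁)]
  exact ENNReal.ofReal_le_ofReal (one_sub_mul_one_sub_le_one_sub_bestOfTwo (hw0 y₁).le (hw0 y₂).le (hw0 x))

/-- `∫ (1 − g) dq = 1 − ∫ g dq` for measurable `g ≤ 1` under the probability law `q`. [ours, bookkeeping] -/
theorem lintegral_one_sub_eq {g : Ω → ℝ≥0∞} (hg : Measurable g) (hg1 : ∀ y, g y ≤ 1) :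
    ∫⁻ y, (1 - g y) ∂q = 1 - ∫⁻ y, g y ∂q := by
  have hle : ∫⁻ y, g y ∂q ≤ 1 := by
    calc ∫⁻ y, g y ∂q ≤ ∫⁻ _, 1 ∂q := lintegral_mono hg1
      _ = 1 := by rw [lintegral_const, measure_univ, mul_one]
  rw [lintegral_sub hg (ne_top_of_le_ne_top ENNReal.one_ne_top hle) (ae_of_all _ hg1), lintegral_one, measure_univ]

/-- **ONE DELAYED-REJECTION UPDATE HOLDS AT LEAST AS OFTEN AS TWO PLAIN UPDATES**: `(1 − A(x))² ≤ 1 − m(x)` — a second chance inside one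
update is weaker than a second update (though cheaper: `2 − A(x)` weight evaluations instead of `2`). [ours] -/
theorem sq_one_sub_acceptMass_le_one_sub_drMass (hw : Measurable w) (hw0 : ∀ x, 0 < w x) (x : Ω) :
    (1 - imhAcceptMass q w x) * (1 - imhAcceptMass q w x) ≤
      1 - (imhAcceptMass q w x +
        ∫⁻ y₁, ∫⁻ y₂, ENNReal.ofReal (min (1 - imhAccept w x y₁) (w y₂ * (1 - imhAccept w y₂ y₁) / w x)) ∂q ∂q) := by
  have ha : Measurable fun y => imhAcceptE w x y := (measurable_imhAcceptE hw).of_uncurry_left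
  have hma : Measurable fun y => 1 - imhAcceptE w x y := measurable_const.sub ha
  have hb := measurable_bestOfTwo hw x
  have hle1 : ∀ y₁ y₂, ENNReal.ofReal (min 1 (max (w y₁) (w y₂) / w x)) ≤ 1 := fun y₁ y₂ => by
    rw [← ENNReal.ofReal_one]; exact ENNReal.ofReal_le_ofReal (min_le_left _ _)
  have hle2 : ∀ y₁, ∫⁻ y₂, ENNReal.ofReal (min 1 (max (w y₁) (w y₂) / w x)) ∂q ≤ 1 := fun y₁ => by
    calc ∫⁻ y₂, ENNReal.ofReal (min 1 (max (w y₁) (w y₂) / w x)) ∂q ≤ ∫⁻ _, 1 ∂q := lintegral_mono fun y₂ => hle1 y₁ y₂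
      _ = 1 := by rw [lintegral_const, measure_univ, mul_one]
  have hsub : 1 - imhAcceptMass q w x = ∫⁻ y, (1 - imhAcceptE w x y) ∂q :=
    (lintegral_one_sub_eq ha (imhAcceptE_le_one w x)).symm
  have hinner : ∀ y₁, 1 - ∫⁻ y₂, ENNReal.ofReal (min 1 (max (w y₁) (w y₂) / w x)) ∂q =
      ∫⁻ y₂, (1 - ENNReal.ofReal (min 1 (max (w y₁) (w y₂) / w x))) ∂q := fun y₁ =>
    (lintegral_one_sub_eq hb.of_uncurry_left (hle1 y₁)).symm
  have houter : 1 - ∫⁻ y₁, ∫⁻ y₂, ENNReal.ofReal (min 1 (max (w y₁) (w y₂) / w x)) ∂q ∂q =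
      ∫⁻ y₁, (1 - ∫⁻ y₂, ENNReal.ofReal (min 1 (max (w y₁) (w y₂) / w x)) ∂q) ∂q :=
    (lintegral_one_sub_eq hb.lintegral_prod_right' hle2).symm
  rw [drMass_eq_bestOfTwo hw hw0 x, houter]
  simp_rw [hinner]
  rw [hsub, ← lintegral_mul_const _ hma]
  refine lintegral_mono fun y₁ => ?_
  rw [← lintegral_const_mul _ hma]
  exact lintegral_mono fun y₂ => one_sub_imhAcceptE_mul_le hw0 x y₁ y₂

end Summit.Ventures.LatticeQCDFlow.Exactness
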